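import Literature.Barriers.FinalStateConjecture.ExtremalHorizonDegenerateEnergyBound
import Literature.Barriers.FinalStateConjecture.ExtremalHorizonCutoffCurrent
import Literature.Barriers.FinalStateConjecture.ExtremalHorizonMultiplierIdentity
import HarnessLib

/-!
# Barrier catalogue `FinalStateConjecture`: the near-horizon non-degenerate energy of Aretakis's
# class is uniformly bounded GIVEN integrated local energy decay in a transition shell
# (Aretakis 2012, §13.1 — the proof of Thm. 2 from Prop. 12.5.1)
# (`Literature/Barriers/FinalStateConjecture/`, D-0021, D-0014; family `gr`)

Written from the proving seat of
`Literature.Barriers.FinalStateConjecture.Aretakis2012_uniformBoundedness` (Aretakis, JFA 263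
(2012), Thm. 2 in shell form). After `ExtremalHorizonDegenerateEnergyBound.lean`
(`Aretakis2012_uniformBoundedness_of_nearHorizonBound`) the named fact is reduced to the uniform
boundedness of `∫₀^{2π}∫₀^π∫_M^{M+δ} sin θ (∂_ρΦ)²` on the leaves `{t* = τ}`, i.e. to Thm. 2 proper,
whose printed proof is §13.1: Stokes' theorem for the cut-off current `J^{N,δ,−1/2}` on
`𝓡(0, τ)`, the sign of its bulk on the collar (Prop. 7.2.1), of its horizon flux, the Hardy
inequalities for the zeroth-order terms, the boundedness of the `T`-flux, and — for the error terms
in the transition region of the cut-off — the integrated local energy decay estimate Prop. 12.5.1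
("Main Estimate II", §§9–12). **This file proves §13.1 for the class with Prop. 12.5.1 as an
explicit hypothesis**, in the catalogue's vocabulary:

* `Kerr.collar_rhoDeriv_sq_le_of_transitionILED` — for a globally smooth, everywhere axisymmetric
  member `Φ` of the class, radii `M < A < B` with `A ≤ 23M/21`, and a bound `I` with
  `∫₀^τ ∫₀^{2π}∫₀^π∫_A^B sin θ (Φ² + (TΦ)² + (∂_ρΦ)² + (∂_ΘΦ)²)(p(t, r, θ, φ)) dt ≤ I` for all
  `τ ≥ 0` (integrated local energy decay in the transition shell `{A ≤ r ≤ B}`, the content of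
  Prop. 12.5.1 there), the collar bound `∫₀^{2π}∫₀^π∫_M^A sin θ (∂_ρΦ)²(p(τ, r, θ, φ)) ≤ C` holds for
  all `τ ≥ 0`, with `C` depending on `Φ` only through `I`, the initial degenerate energy `E₀` and
  the initial `N`-energy;
* `Aretakis2012_uniformBoundedness_of_transitionILED` — hence the named fact follows from that
  integrated decay statement for the class (combine with
  `Aretakis2012_uniformBoundedness_of_nearHorizonBound`, `δ = A − M`).

The multiplier is `X = f∂_r + h∂_{t*}` with Lagrangian coefficient `w`, where
`(f, h, w) = (χN^Y, χ(N^T − N^Y) + (1 − χ), −χ/2)` for a smooth cut-off `χ` equal to `1` near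
`[M, A]` and to `0` near `[B, ∞)` (`N` Aretakis's field of §7.2, `KerrStarHorizonCurrent.lean`); the
energy identity is `Kerr.mult_identity_of_class` (`ExtremalHorizonMultiplierIdentity.lean`), the
pointwise algebra is `ExtremalHorizonCutoffCurrent.lean`, the zeroth-order and degenerate terms are
absorbed by `ExtremalHorizonDegenerateEnergyBound.lean` (Hardy: `∫ sin θ Φ² ≤ 8E₀`; `∫ e_T ≤ E₀`).
Everything is proved; no named facts (D-0026). What remains between the catalogue and
`Aretakis2012_uniformBoundedness` is exactly the hypothesis `I < ∞`: Prop. 12.5.1 of the source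
on a thin shell away from `𝓗⁺` and from the effective photon sphere `r = (1 + √2)M`.

## References

* S. Aretakis, *Decay of axisymmetric solutions of the wave equation on extreme Kerr
  backgrounds*, J. Funct. Anal. 263 (2012) 2770–2831 (arXiv:1110.2006): §13.1 (proof of Thm. 2),
  §7.2 (Prop. 7.2.1), §12.5 (Prop. 12.5.1), §4.4, §5.1. [Aretakis2012]
-/

noncomputable section

open Real Set Filter MeasureTheory intervalIntegral
open scoped Topology ContDiff Manifold

namespace Literature.Barriers.FinalStateConjecture.Kerr

open Literature.Geometry.Lorentzian Literature.Geometry.Lorentzian.Kerr.StarCoord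

/-! ### Helpers: continuity of the box points and of box integrals in parameters -/

/-- Joint continuity of `(t, r, θ, φ₀) ↦ (t, r, θ, φ₀)` as a box point. [folklore] -/
theorem continuous_boxPoint₄ :
    Continuous fun q : ℝ × ℝ × ℝ × ℝ ↦ boxPoint q.2.2.2 q.1 q.2.1 q.2.2.1 := by
  unfold boxPoint
  refine continuous_toLp_four ?_ ?_ ?_ ?_ <;> fun_prop

/-- Continuity in `t` of `∫₀^π∫_a^b g(t, r, θ) dr dθ` for a jointly continuous `g`. [folklore] -/
theorem continuous_boxIntegral_param {g : ℝ → ℝ → ℝ → ℝ}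
    (hg : Continuous fun p : ℝ × ℝ × ℝ ↦ g p.1 p.2.1 p.2.2) (a b : ℝ) :
    Continuous fun t ↦ ∫ θ in (0 : ℝ)..π, ∫ r in a..b, g t r θ := by
  have h1 : Continuous (Function.uncurry fun (p : ℝ × ℝ) r ↦ g p.1 r p.2) := by
    have hc : Continuous fun x : (ℝ × ℝ) × ℝ ↦ ((x.1.1, x.2, x.1.2) : ℝ × ℝ × ℝ) := by fun_prop
    have h := hg.comp hc
    rw [Function.comp_def] at h
    exact h
  have h2 : Continuous fun p : ℝ × ℝ ↦ ∫ r in a..b, g p.1 r p.2 :=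
    intervalIntegral.continuous_parametric_intervalIntegral_of_continuous' h1 a b
  have h3 : Continuous (Function.uncurry fun t θ ↦ ∫ r in a..b, g t r θ) := h2
  exact intervalIntegral.continuous_parametric_intervalIntegral_of_continuous' h3 0 π

/-- Continuity in `(t, φ)` of `∫₀^π∫_a^b J(t, r, θ, φ) dr dθ` for a jointly continuous `J`.
[folklore] -/
theorem continuous_boxIntegral_param₂ {J : ℝ → ℝ → ℝ → ℝ → ℝ}
    (hJ : Continuous fun q : ℝ × ℝ × ℝ × ℝ ↦ J q.1 q.2.1 q.2.2.1 q.2.2.2) (a b : ℝ) :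
    Continuous fun p : ℝ × ℝ ↦ ∫ θ in (0 : ℝ)..π, ∫ r in a..b, J p.1 r θ p.2 := by
  have h1 : Continuous (Function.uncurry fun (x : (ℝ × ℝ) × ℝ) r ↦ J x.1.1 r x.2 x.1.2) := by
    have hc : Continuous fun y : ((ℝ × ℝ) × ℝ) × ℝ ↦
        ((y.1.1.1, y.2, y.1.2, y.1.1.2) : ℝ × ℝ × ℝ × ℝ) := by fun_prop
    have h := hJ.comp hc
    rw [Function.comp_def] at h
    exact h
  have h2 : Continuous fun x : (ℝ × ℝ) × ℝ ↦ ∫ r in a..b, J x.1.1 r x.2 x.1.2 :=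
    intervalIntegral.continuous_parametric_intervalIntegral_of_continuous' h1 a b
  have h3 : Continuous (Function.uncurry fun (p : ℝ × ℝ) θ ↦ ∫ r in a..b, J p.1 r θ p.2) := h2
  exact intervalIntegral.continuous_parametric_intervalIntegral_of_continuous' h3 0 π

/-- For fixed `t`, a jointly continuous `g(t, r, θ)` is jointly continuous in `(r, θ)`. [folklore] -/
theorem continuous_uncurry_of_param {g : ℝ → ℝ → ℝ → ℝ}
    (hg : Continuous fun p : ℝ × ℝ × ℝ ↦ g p.1 p.2.1 p.2.2) (t : ℝ) :
    Continuous (Function.uncurry fun r θ ↦ g t r θ) := by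
  have hc : Continuous fun x : ℝ × ℝ ↦ ((t, x.1, x.2) : ℝ × ℝ × ℝ) := by fun_prop
  have h := hg.comp hc
  rw [Function.comp_def] at h
  exact h

/-- Sums of box integrals of jointly continuous integrands. [folklore] -/
theorem boxIntegral_add {a b : ℝ} {f g : ℝ → ℝ → ℝ} (hf : Continuous (Function.uncurry f))
    (hg : Continuous (Function.uncurry g)) :
    (∫ θ in (0 : ℝ)..π, ∫ r in a..b, (f r θ + g r θ)) =
      (∫ θ in (0 : ℝ)..π, ∫ r in a..b, f r θ) + ∫ θ in (0 : ℝ)..π, ∫ r in a..b, g r θ := by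
  rw [← intervalIntegral.integral_add ((continuous_rIntegral hf).intervalIntegrable _ _)
    ((continuous_rIntegral hg).intervalIntegrable _ _)]
  refine intervalIntegral.integral_congr fun θ _ ↦ ?_
  have hfr : Continuous fun r ↦ f r θ := hf.comp (Continuous.prodMk continuous_id continuous_const)
  have hgr : Continuous fun r ↦ g r θ := hg.comp (Continuous.prodMk continuous_id continuous_const)
  exact intervalIntegral.integral_add (hfr.intervalIntegrable _ _) (hgr.intervalIntegrable _ _)

/-- A box integral of a non-positive continuous integrand is non-positive (`a ≤ b`). [folklore] -/
theorem boxIntegral_nonpos {a b : ℝ} (hab : a ≤ b) {g : ℝ → ℝ → ℝ}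
    (hg : Continuous (Function.uncurry g))
    (h : ∀ r ∈ Icc a b, ∀ θ ∈ Icc (0 : ℝ) π, g r θ ≤ 0) :
    (∫ θ in (0 : ℝ)..π, ∫ r in a..b, g r θ) ≤ 0 := by
  have h0 := boxIntegral_mono_on hab hg continuous_const (f := g) (g := fun _ _ ↦ (0 : ℝ)) h
  simpa using h0

/-- A box integral of a non-negative continuous integrand is non-negative (`a ≤ b`). [folklore] -/
theorem boxIntegral_nonneg {a b : ℝ} (hab : a ≤ b) {g : ℝ → ℝ → ℝ}
    (hg : Continuous (Function.uncurry g))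
    (h : ∀ r ∈ Icc a b, ∀ θ ∈ Icc (0 : ℝ) π, 0 ≤ g r θ) :
    0 ≤ ∫ θ in (0 : ℝ)..π, ∫ r in a..b, g r θ := by
  have h0 := boxIntegral_mono_on hab continuous_const hg (f := fun _ _ ↦ (0 : ℝ)) (g := g) h
  simpa using h0

/-! ### Helpers: the `T`-energy density, the dictionary, the cut-off -/

/-- The coordinate `T`-energy density is non-negative on extremal Kerr for `r ≥ 0`, `θ ∈ [0, π]`
(`Δ = (r − M)²`). [cite: Aretakis2012, §5.1 (Prop. 5.1.1)] -/
theorem tEnergy_extremal_nonneg {M : ℝ} (hM : 0 ≤ M) (G : E4 → ℝ) {q : E4} (hr : 0 ≤ q 1)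
    (hθ : q 2 ∈ Icc 0 π) : 0 ≤ tEnergy M M G q := by
  have hs : 0 ≤ sin (q 2) := sin_nonneg_of_nonneg_of_le_pi hθ.1 hθ.2
  have hΔ : 0 ≤ q 1 ^ 2 - 2 * M * q 1 + M ^ 2 := by nlinarith [sq_nonneg (q 1 - M)]
  have hS : 0 ≤ q 1 ^ 2 + M ^ 2 * cos (q 2) ^ 2 + 2 * M * q 1 := by positivity
  simp only [tEnergy]
  exact mul_nonneg (mul_nonneg (by norm_num) hs) (add_nonneg (add_nonneg (mul_nonneg hΔ (sq_nonneg _))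
    (mul_nonneg hS (sq_nonneg _))) (sq_nonneg _))

/-- **A smooth plateau cut-off**: `χ ∈ C^∞(ℝ)` with `χ = 1` on `(−∞, A']` and `χ = 0` on
`[B', ∞)` (`A' < B'`), from `Real.smoothTransition`. [folklore] -/
theorem exists_smooth_plateau {A' B' : ℝ} (h : A' < B') :
    ∃ χ : ℝ → ℝ, ContDiff ℝ ∞ χ ∧ (∀ r, r ≤ A' → χ r = 1) ∧ (∀ r, B' ≤ r → χ r = 0) := by
  refine ⟨fun r ↦ Real.smoothTransition ((B' - r) / (B' - A')), ?_, ?_, ?_⟩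
  · exact Real.smoothTransition.contDiff.comp (by fun_prop)
  · intro r hr
    refine Real.smoothTransition.one_of_one_le ?_
    rw [le_div_iff₀ (by linarith)]
    linarith
  · intro r hr
    refine Real.smoothTransition.zero_of_nonpos ?_
    exact div_nonpos_of_nonpos_of_nonneg (by linarith) (by linarith)

/-! ### §13.1: the collar bound from integrated decay in the transition shell -/

section Collar

variable [Kerr.Facts] [Kerr.SliceFacts] {M r₀ : ℝ} {U₀ : Set (Kerr.region M r₀)} {Φ : E4 → ℝ}

/-- **Aretakis 2012, §13.1 for the class, with Prop. 12.5.1 as hypothesis: the non-degenerate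
transversal energy on the collar `{M ≤ r ≤ A}` is uniformly bounded in time as soon as the
energy-type spacetime integral over the transition shell `{A ≤ r ≤ B}` is.** Let `Φ` be a globally
smooth, everywhere axisymmetric member of Aretakis's class (`□_{g_{M,M}}Φ = 0` on an open
`U₀ ⊇ {r ≥ M, t* ≥ 0}`, data vanishing on `{t* = 0, ‖x⃗‖ > ρ}`), `M < A < B`, `A ≤ 23M/21`, and
suppose `∫₀^τ ∫₀^{2π}∫₀^π∫_A^B sin θ (Φ² + (TΦ)² + (∂_ρΦ)² + (∂_ΘΦ)²)(p(t, r, θ, φ)) dt ≤ I` for all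
`τ ≥ 0` (`TΦ = dΦ(p)∂_{t*}`, `∂_ρΦ = dΦ(p)(0, n̂)`, `∂_ΘΦ = dΦ(p)(0, rθ̂ + M cos θ φ̂)`). Then there is
`C` with `∫₀^{2π}∫₀^π∫_M^A sin θ (∂_ρΦ)²(p(τ, r, θ, φ)) ≤ C` for all `τ ≥ 0`. Proof (§13.1): the
energy identity `Kerr.mult_identity_of_class` for the cut-off current (profiles
`(χN^Y, χ(N^T − N^Y) + (1 − χ), −χ/2)`) on `[0, τ] × [M, r₂]`, `r₂` beyond the support; the horizon
flux is `≥ 0` (`multFluxR_nCurrent_horizon_nonneg`), the bulk is `≤ 0` on the collar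
(`multBulk_nCurrent_nonpos`, Prop. 7.2.1), vanishes beyond `B` (`multBulk_T`) and is bounded by
`K sin θ (|∂G|² + G²)` in the transition shell (`exists_bound_multBulk`), whence by the hypothesis;
the density controls `(M³/16) sin θ (∂_ρΦ)²` on the collar up to `70M sin θ Φ²`
(`nEnergy_collar_ge`), is bounded in the shell (`exists_bound_multDensity`, then
`sin_mul_sq_le_tEnergy`) and equals `−e_T ≤ 0` beyond `B`; the zeroth-order and degenerate terms are
bounded by `8E₀` and `E₀` (`shellIntegral_sq_le_initialEnergy`, `degTEnergyShell_le_initial` — the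
first Hardy inequality and the boundedness of the `T`-flux); at `t* = 0` the density vanishes
beyond `R₀ = max(ρ, 2M) + 2`. All identities are per unit `φ*` and are integrated over
`φ₀ ∈ [0, 2π]` at the end (Fubini for the time integral). [cite: Aretakis2012, §13.1] -/
theorem collar_rhoDeriv_sq_le_of_transitionILED (hM : 0 < M) (hr₀ : r₀ ∈ Set.Ioo 0 M)
    (hU₀ : IsOpen U₀)
    (hKU : {x : Kerr.region M r₀ | Kerr.rPlus M M ≤ Kerr.radius M (x : E4) ∧ 0 ≤ (x : E4) 0} ⊆ U₀)
    (hΦ : ContDiff ℝ ∞ Φ)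
    (haxi : ∀ (β : ℝ) (z : E4), Φ (E4.axialRotation β z) = Φ z)
    (hsol : ∀ x ∈ U₀, (Kerr.smoothMetric M M r₀).toPseudoRiemannianMetric.dalembertian
      (fun y : Kerr.region M r₀ ↦ Φ y) x = 0)
    {ρ : ℝ} (hloc : ∀ x ∈ U₀, (x : E4) 0 = 0 → ρ < E4.spatialNorm (x : E4) →
      Φ x = 0 ∧ fderiv ℝ Φ x = 0)
    {A B I : ℝ} (hMA : M < A) (hAB : A < B) (hA23 : A ≤ 23 / 21 * M)
    (hI : ∀ τ : ℝ, 0 ≤ τ → (∫ t in (0 : ℝ)..τ, shellIntegral A B (fun r θ φ ↦ sin θ *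
        (Φ (shellPoint M t r θ φ) ^ 2 +
          (fderiv ℝ Φ (shellPoint M t r θ φ) (E4.basisVector 0)) ^ 2 +
          (fderiv ℝ Φ (shellPoint M t r θ φ) (E4.spaceEmbed (sphRadial θ φ))) ^ 2 +
          (fderiv ℝ Φ (shellPoint M t r θ φ)
            (E4.spaceEmbed (r • sphPolar θ φ + (M * cos θ) • sphAzimuth φ))) ^ 2))) ≤ I) :
    ∃ C : ℝ, ∀ τ : ℝ, 0 ≤ τ →
      shellIntegral M A (fun r θ φ ↦ sin θ *
        (fderiv ℝ Φ (shellPoint M τ r θ φ) (E4.spaceEmbed (sphRadial θ φ))) ^ 2) ≤ C := by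
  obtain ⟨hr₀pos, hr₀M⟩ := hr₀
  have hπ := pi_pos
  have hΦ' : ∀ x ∈ U₀, ContDiffAt ℝ ∞ Φ x := fun x _ ↦ hΦ.contDiffAt
  have haxi' : ∀ (β : ℝ) (z : E4), 0 < Kerr.radius M z → Φ (E4.axialRotation β z) = Φ z :=
    fun β z _ ↦ haxi β z
  have hdiff : Differentiable ℝ Φ := hΦ.differentiable (by simp)
  have hMA' : M ≤ A := hMA.le
  have hMB : M ≤ B := hMA'.trans hAB.le
  /- ## the pull-back `G = Φ ∘ κ` and the dictionary at box points -/
  have hGs : ContDiff ℝ ∞ (Kerr.starPull M Φ) := hΦ.comp (Kerr.contDiff_starChart M)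
  have dict0 : ∀ t r θ φ, Kerr.starPull M Φ (boxPoint φ t r θ) = Φ (shellPoint M t r θ φ) := by
    intro t r θ φ; rw [Kerr.starPull_apply, starChart_boxPoint]
  have dictT : ∀ t r θ φ, pd 0 (Kerr.starPull M Φ) (boxPoint φ t r θ) =
      fderiv ℝ Φ (shellPoint M t r θ φ) (E4.basisVector 0) := by
    intro t r θ φ; rw [pd_starPull_boxPoint (hdiff _) 0, Kerr.starFrame_zero]
  have dictR : ∀ t r θ φ, pd 1 (Kerr.starPull M Φ) (boxPoint φ t r θ) =
      fderiv ℝ Φ (shellPoint M t r θ φ) (E4.spaceEmbed (sphRadial θ φ)) := by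
    intro t r θ φ; rw [pd_starPull_boxPoint (hdiff _) 1, Kerr.starFrame_one]; rfl
  have dictΘ : ∀ t r θ φ, pd 2 (Kerr.starPull M Φ) (boxPoint φ t r θ) =
      fderiv ℝ Φ (shellPoint M t r θ φ)
        (E4.spaceEmbed (r • sphPolar θ φ + (M * cos θ) • sphAzimuth φ)) := by
    intro t r θ φ; rw [pd_starPull_boxPoint (hdiff _) 2, Kerr.starFrame_two]; rfl
  /- ## the cut-off and the profiles -/
  obtain ⟨χ, hχ, hχ1, hχ0⟩ := exists_smooth_plateau (A' := A + (B - A) / 3)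
    (B' := B - (B - A) / 3) (by linarith)
  obtain ⟨f, hfdef⟩ : ∃ f : ℝ → ℝ, f = fun r ↦ χ r * nProfileR M r := ⟨_, rfl⟩
  obtain ⟨h, hhdef⟩ : ∃ h : ℝ → ℝ, h = fun r ↦ χ r * nProfileT M r + (1 - χ r) := ⟨_, rfl⟩
  obtain ⟨w, hwdef⟩ : ∃ w : ℝ → ℝ, w = fun r ↦ χ r * nProfileW r := ⟨_, rfl⟩
  have hf : ContDiff ℝ ∞ f := by rw [hfdef]; exact hχ.mul (contDiff_nProfileR M)
  have hh : ContDiff ℝ ∞ h := by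
    rw [hhdef]; exact (hχ.mul (contDiff_nProfileT M)).add (contDiff_const.sub hχ)
  have hw : ContDiff ℝ ∞ w := by rw [hwdef]; exact hχ.mul contDiff_nProfileW
  have hχ1ev : ∀ r, r ≤ A → ∀ᶠ s in 𝓝 r, χ s = 1 := fun r hr ↦ by
    filter_upwards [Iio_mem_nhds (show r < A + (B - A) / 3 by linarith)] with s hs
    exact hχ1 s (le_of_lt hs)
  have hχ0ev : ∀ r, B ≤ r → ∀ᶠ s in 𝓝 r, χ s = 0 := fun r hr ↦ by
    filter_upwards [Ioi_mem_nhds (show B - (B - A) / 3 < r by linarith)] with s hs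
    exact hχ0 s (le_of_lt hs)
  have hfN : ∀ r, r ≤ A → f =ᶠ[𝓝 r] nProfileR M := fun r hr ↦ by
    filter_upwards [hχ1ev r hr] with s hs; rw [hfdef]; simp [hs]
  have hhN : ∀ r, r ≤ A → h =ᶠ[𝓝 r] nProfileT M := fun r hr ↦ by
    filter_upwards [hχ1ev r hr] with s hs; rw [hhdef]; simp [hs]
  have hwN : ∀ r, r ≤ A → w =ᶠ[𝓝 r] nProfileW := fun r hr ↦ by
    filter_upwards [hχ1ev r hr] with s hs; rw [hwdef]; simp [hs]
  have hfT : ∀ r, B ≤ r → f =ᶠ[𝓝 r] fun _ ↦ 0 := fun r hr ↦ by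
    filter_upwards [hχ0ev r hr] with s hs; rw [hfdef]; simp [hs]
  have hhT : ∀ r, B ≤ r → h =ᶠ[𝓝 r] fun _ ↦ 1 := fun r hr ↦ by
    filter_upwards [hχ0ev r hr] with s hs; rw [hhdef]; simp [hs]
  have hwT : ∀ r, B ≤ r → w =ᶠ[𝓝 r] fun _ ↦ 0 := fun r hr ↦ by
    filter_upwards [hχ0ev r hr] with s hs; rw [hwdef]; simp [hs]
  /- ## continuity of the densities of the cut-off current along the boxes -/
  obtain ⟨hEs, -, -, hBc⟩ := contDiffOn_mult (M := M) (a := M) isOpen_univ hGs.contDiffOn hf hh hw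
  have cE : Continuous (multDensity M M f h w (Kerr.starPull M Φ)) :=
    (contDiffOn_univ.mp hEs).continuous
  have cB : Continuous (multBulk M M f h w (Kerr.starPull M Φ)) := continuousOn_univ.mp hBc
  have cE4 : Continuous fun q : ℝ × ℝ × ℝ × ℝ ↦
      multDensity M M f h w (Kerr.starPull M Φ) (boxPoint q.2.2.2 q.1 q.2.1 q.2.2.1) := by
    have hc := cE.comp continuous_boxPoint₄; rw [Function.comp_def] at hc; exact hc
  have cE3 : ∀ φ₀, Continuous fun p : ℝ × ℝ × ℝ ↦
      multDensity M M f h w (Kerr.starPull M Φ) (boxPoint φ₀ p.1 p.2.1 p.2.2) := fun φ₀ ↦ by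
    have hc := cE.comp (continuous_boxPoint φ₀); rw [Function.comp_def] at hc; exact hc
  have cB3 : ∀ φ₀, Continuous fun p : ℝ × ℝ × ℝ ↦
      multBulk M M f h w (Kerr.starPull M Φ) (boxPoint φ₀ p.1 p.2.1 p.2.2) := fun φ₀ ↦ by
    have hc := cB.comp (continuous_boxPoint φ₀); rw [Function.comp_def] at hc; exact hc
  -- the energy-type density `J = sin θ ((∂_{t*}G)² + (∂_rG)² + (∂_θG)² + G²)` and its pieces
  have cpd : ∀ i, Continuous fun q : ℝ × ℝ × ℝ × ℝ ↦
      pd i (Kerr.starPull M Φ) (boxPoint q.2.2.2 q.1 q.2.1 q.2.2.1) := fun i ↦ by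
    have hc := ((hGs.continuous_fderiv (by simp)).clm_apply continuous_const :
      Continuous fun q : E4 ↦ fderiv ℝ (Kerr.starPull M Φ) q (E4.basisVector i)).comp
      continuous_boxPoint₄
    rw [Function.comp_def] at hc; exact hc
  have cG4 : Continuous fun q : ℝ × ℝ × ℝ × ℝ ↦
      Kerr.starPull M Φ (boxPoint q.2.2.2 q.1 q.2.1 q.2.2.1) := by
    have hc := hGs.continuous.comp continuous_boxPoint₄; rw [Function.comp_def] at hc; exact hc
  have csin4 : Continuous fun q : ℝ × ℝ × ℝ × ℝ ↦ sin q.2.2.1 := by fun_prop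
  obtain ⟨J, hJ⟩ : ∃ J : ℝ → ℝ → ℝ → ℝ → ℝ, J = fun t r θ φ ↦ sin θ *
      (pd 0 (Kerr.starPull M Φ) (boxPoint φ t r θ) ^ 2 + pd 1 (Kerr.starPull M Φ) (boxPoint φ t r θ) ^ 2 +
        pd 2 (Kerr.starPull M Φ) (boxPoint φ t r θ) ^ 2 + Kerr.starPull M Φ (boxPoint φ t r θ) ^ 2) :=
    ⟨_, rfl⟩
  have cJ4 : Continuous fun q : ℝ × ℝ × ℝ × ℝ ↦ J q.1 q.2.1 q.2.2.1 q.2.2.2 := by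
    rw [hJ]
    exact csin4.mul (((((cpd 0).pow 2).add ((cpd 1).pow 2)).add ((cpd 2).pow 2)).add (cG4.pow 2))
  -- the transversal and zeroth-order densities on the collar
  obtain ⟨P₁, hP₁⟩ : ∃ P₁ : ℝ → ℝ → ℝ → ℝ → ℝ, P₁ = fun t r θ φ ↦ sin θ *
      pd 1 (Kerr.starPull M Φ) (boxPoint φ t r θ) ^ 2 := ⟨_, rfl⟩
  have cP₁ : Continuous fun q : ℝ × ℝ × ℝ × ℝ ↦ P₁ q.1 q.2.1 q.2.2.1 q.2.2.2 := by
    rw [hP₁]; exact csin4.mul ((cpd 1).pow 2)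
  obtain ⟨Z₁, hZ₁⟩ : ∃ Z₁ : ℝ → ℝ → ℝ → ℝ → ℝ, Z₁ = fun t r θ φ ↦ sin θ *
      Kerr.starPull M Φ (boxPoint φ t r θ) ^ 2 := ⟨_, rfl⟩
  have cZ₁ : Continuous fun q : ℝ × ℝ × ℝ × ℝ ↦ Z₁ q.1 q.2.1 q.2.2.1 q.2.2.2 := by
    rw [hZ₁]; exact csin4.mul (cG4.pow 2)
  /- ## the constants -/
  obtain ⟨Kb, hKb0, hKb⟩ := exists_bound_multBulk M M A B hf hh hw
  obtain ⟨Ke, hKe0, hKe⟩ := exists_bound_multDensity M M A B hf hh hw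
  obtain ⟨E₀, hE₀⟩ : ∃ E₀ : ℝ, E₀ = shellIntegral M (max ρ (2 * M) + 2)
      (fun r θ φ ↦ degTEnergyDensity M Φ 0 r θ φ) := ⟨_, rfl⟩
  have hE₀0 : 0 ≤ E₀ := hE₀ ▸ initialDegTEnergyShell_nonneg hM hΦ ρ
  obtain ⟨m₀, hm₀⟩ : ∃ m₀ : ℝ, m₀ = min (min ((A - M) ^ 2) (A ^ 2)) 1 := ⟨_, rfl⟩
  have hm₀pos : 0 < m₀ := by
    rw [hm₀]; exact lt_min (lt_min (by nlinarith) (by nlinarith)) zero_lt_one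
  -- the initial `N`-energy per unit `φ*` and its integral
  obtain ⟨Einit, hEinit⟩ : ∃ Einit : ℝ → ℝ, Einit = fun φ₀ ↦ ∫ θ in (0 : ℝ)..π,
      ∫ r in M..(max ρ (2 * M) + 2), multDensity M M f h w (Kerr.starPull M Φ) (boxPoint φ₀ 0 r θ) :=
    ⟨_, rfl⟩
  have cEinit : Continuous Einit := by
    rw [hEinit]
    have hc := continuous_boxIntegral_param₂
      (J := fun t r θ φ ↦ multDensity M M f h w (Kerr.starPull M Φ) (boxPoint φ t r θ)) cE4 M
      (max ρ (2 * M) + 2)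
    have hc2 : Continuous fun φ₀ : ℝ ↦ ((0, φ₀) : ℝ × ℝ) := by fun_prop
    have hc3 := hc.comp hc2
    rw [Function.comp_def] at hc3
    exact hc3
  obtain ⟨Cinit, hCinit⟩ : ∃ Cinit : ℝ, Cinit = ∫ φ₀ in (0 : ℝ)..2 * π, Einit φ₀ := ⟨_, rfl⟩
  -- the final constant
  refine ⟨16 / M ^ 3 * (|Cinit| + Kb * |I| + 70 * M * (8 * E₀) + Ke * (2 / m₀ * E₀ + 8 * E₀)),
    fun τ hτ ↦ ?_⟩
  /- ## the outer radius, beyond the support of the wave on `[0, τ]` -/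
  obtain ⟨r₂, hr₂⟩ : ∃ r₂ : ℝ, r₂ = max B (max ρ (2 * M) + τ + 2) := ⟨_, rfl⟩
  have hBr₂ : B ≤ r₂ := hr₂ ▸ le_max_left _ _
  have hr₂' : max ρ (2 * M) + τ + 2 ≤ r₂ := hr₂ ▸ le_max_right _ _
  have hfar₂ : max ρ (2 * M) + 1 + τ < r₂ := by linarith
  have hR₀r₂ : max ρ (2 * M) + 2 ≤ r₂ := by linarith
  have hMr₂ : M ≤ r₂ := hMB.trans hBr₂
  have hMR₀ : M ≤ max ρ (2 * M) + 2 := by have := le_max_right ρ (2 * M); linarith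
  /- ## the per-`φ₀` estimate -/
  have key : ∀ φ₀ : ℝ,
      M ^ 3 / 16 * (∫ θ in (0 : ℝ)..π, ∫ r in M..A, P₁ τ r θ φ₀) ≤
        -Einit φ₀ + Kb * (∫ t in (0 : ℝ)..τ, ∫ θ in (0 : ℝ)..π, ∫ r in A..B, J t r θ φ₀) +
          70 * M * (∫ θ in (0 : ℝ)..π, ∫ r in M..A, Z₁ τ r θ φ₀) +
          Ke * (∫ θ in (0 : ℝ)..π, ∫ r in A..B, J τ r θ φ₀) := by
    intro φ₀
    -- (I) the energy identity and the sign of the horizon flux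
    have hid := mult_identity_of_class hM ⟨hr₀pos, hr₀M⟩ hU₀ hKU hΦ' haxi' hsol hloc hf hh hw
      (t₁ := 0) (t₂ := τ) (T := τ) (r₂ := r₂) (φ₀ := φ₀) le_rfl hτ le_rfl hfar₂
    have hF : 0 ≤ ∫ t in (0 : ℝ)..τ, ∫ θ in (0 : ℝ)..π,
        multFluxR M M f h w (Kerr.starPull M Φ) (boxPoint φ₀ t M θ) := by
      refine intervalIntegral.integral_nonneg hτ fun t _ ↦
        intervalIntegral.integral_nonneg hπ.le fun θ hθ ↦ ?_
      rw [multFluxR_congr_nhds (f₂ := nProfileR M) (h₂ := nProfileT M) (w₂ := nProfileW)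
        (by rw [boxPoint_apply_one]; exact (hfN M hMA').eq_of_nhds)
        (by rw [boxPoint_apply_one]; exact (hhN M hMA').eq_of_nhds)
        (by rw [boxPoint_apply_one]; exact hwN M hMA')]
      exact multFluxR_nCurrent_horizon_nonneg hM.le _ (boxPoint_apply_one _ _ _ _)
        (by rw [boxPoint_apply_two]; exact hθ)
    -- (II) the bulk: sign on the collar, zero beyond `B`, bounded in the shell
    have hIb : ∀ t ∈ Icc 0 τ, (∫ θ in (0 : ℝ)..π, ∫ r in M..r₂,
        multBulk M M f h w (Kerr.starPull M Φ) (boxPoint φ₀ t r θ)) ≤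
        Kb * ∫ θ in (0 : ℝ)..π, ∫ r in A..B, J t r θ φ₀ := by
      intro t _
      have hc := continuous_uncurry_of_param
        (g := fun t r θ ↦ multBulk M M f h w (Kerr.starPull M Φ) (boxPoint φ₀ t r θ)) (cB3 φ₀) t
      rw [boxIntegral_split (b := A) hc, boxIntegral_split (a := A) (b := B) (c := r₂) hc]
      have h1 : (∫ θ in (0 : ℝ)..π, ∫ r in M..A,
          multBulk M M f h w (Kerr.starPull M Φ) (boxPoint φ₀ t r θ)) ≤ 0 := by
        refine boxIntegral_nonpos hMA' hc fun r hr θ hθ ↦ ?_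
        rw [multBulk_congr_nhds (f₂ := nProfileR M) (h₂ := nProfileT M) (w₂ := nProfileW)
          (by rw [boxPoint_apply_one]; exact hfN r hr.2)
          (by rw [boxPoint_apply_one]; exact hhN r hr.2)
          (by rw [boxPoint_apply_one]; exact hwN r hr.2)]
        exact multBulk_nCurrent_nonpos hM _ (by rw [boxPoint_apply_one]; exact hr.1)
          (by rw [boxPoint_apply_one]; exact hr.2.trans hA23) (by rw [boxPoint_apply_two]; exact hθ)
      have h2 : (∫ θ in (0 : ℝ)..π, ∫ r in A..B,
          multBulk M M f h w (Kerr.starPull M Φ) (boxPoint φ₀ t r θ)) ≤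
          ∫ θ in (0 : ℝ)..π, ∫ r in A..B, Kb * J t r θ φ₀ := by
        have hcJ : Continuous (Function.uncurry fun r θ ↦ Kb * J t r θ φ₀) := by
          have hc1 : Continuous fun x : ℝ × ℝ ↦ ((t, x.1, x.2, φ₀) : ℝ × ℝ × ℝ × ℝ) := by fun_prop
          have hc2 := cJ4.comp hc1
          rw [Function.comp_def] at hc2
          exact continuous_const.mul hc2
        refine boxIntegral_mono_on hAB.le hc hcJ fun r hr θ hθ ↦ (le_abs_self _).trans ?_
        have hb := hKb (Kerr.starPull M Φ) (boxPoint φ₀ t r θ) (by rw [boxPoint_apply_one]; exact hr)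
          (by rw [boxPoint_apply_two]; exact hθ)
        rw [hJ]; simpa only [boxPoint_apply_two] using hb
      have h3 : (∫ θ in (0 : ℝ)..π, ∫ r in B..r₂,
          multBulk M M f h w (Kerr.starPull M Φ) (boxPoint φ₀ t r θ)) = 0 := by
        refine boxIntegral_eq_zero_of fun r hr θ _ ↦ ?_
        rw [uIcc_of_le hBr₂] at hr
        rw [multBulk_congr_nhds (f₂ := fun _ ↦ 0) (h₂ := fun _ ↦ 1) (w₂ := fun _ ↦ 0)
          (by rw [boxPoint_apply_one]; exact hfT r hr.1)
          (by rw [boxPoint_apply_one]; exact hhT r hr.1)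
          (by rw [boxPoint_apply_one]; exact hwT r hr.1)]
        exact multBulk_T M M _ _
      rw [boxIntegral_const_mul] at h2
      linarith
    -- (III) integrate the bulk bound in time
    have hIbt : (∫ t in (0 : ℝ)..τ, ∫ θ in (0 : ℝ)..π, ∫ r in M..r₂,
        multBulk M M f h w (Kerr.starPull M Φ) (boxPoint φ₀ t r θ)) ≤
        Kb * ∫ t in (0 : ℝ)..τ, ∫ θ in (0 : ℝ)..π, ∫ r in A..B, J t r θ φ₀ := by
      rw [← intervalIntegral.integral_const_mul]
      have hcJt : Continuous fun t ↦ ∫ θ in (0 : ℝ)..π, ∫ r in A..B, J t r θ φ₀ := by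
        have hc1 : Continuous fun p : ℝ × ℝ × ℝ ↦ ((p.1, p.2.1, p.2.2, φ₀) : ℝ × ℝ × ℝ × ℝ) := by
          fun_prop
        have hc2 := cJ4.comp hc1
        rw [Function.comp_def] at hc2
        exact continuous_boxIntegral_param (g := fun t r θ ↦ J t r θ φ₀) hc2 A B
      exact intervalIntegral.integral_mono_on hτ
        ((continuous_boxIntegral_param
          (g := fun t r θ ↦ multBulk M M f h w (Kerr.starPull M Φ) (boxPoint φ₀ t r θ)) (cB3 φ₀) M r₂).intervalIntegrable _ _)
        ((continuous_const.mul hcJt).intervalIntegrable _ _) fun t ht ↦ by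
          simpa only using (hIb t ht)
    -- (IV) the initial energy: the density vanishes beyond `R₀` at `t* = 0`
    have hI0 : (∫ θ in (0 : ℝ)..π, ∫ r in M..r₂,
        multDensity M M f h w (Kerr.starPull M Φ) (boxPoint φ₀ 0 r θ)) = Einit φ₀ := by
      rw [hEinit]
      have hc := continuous_uncurry_of_param
        (g := fun t r θ ↦ multDensity M M f h w (Kerr.starPull M Φ) (boxPoint φ₀ t r θ)) (cE3 φ₀) 0
      rw [boxIntegral_split (b := max ρ (2 * M) + 2) hc,
        boxIntegral_eq_zero_of (a := max ρ (2 * M) + 2) (b := r₂), add_zero]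
      intro r hr θ _
      rw [uIcc_of_le hR₀r₂] at hr
      have hfar₀ : max ρ (2 * M) + 1 + 0 < r := by linarith [hr.1]
      obtain ⟨hΦ0, hdΦ0⟩ := fderiv_shellPoint_eq_zero_of_far hM ⟨hr₀pos, hr₀M⟩ hU₀ hKU hΦ' hsol
        hloc hfar₀ le_rfl le_rfl θ φ₀
      have hG0 : Kerr.starPull M Φ (boxPoint φ₀ 0 r θ) = 0 := by rw [dict0]; exact hΦ0
      have hpd : ∀ i, pd i (Kerr.starPull M Φ) (boxPoint φ₀ 0 r θ) = 0 := fun i ↦ by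
        rw [pd_starPull_boxPoint (hdiff _) i, hdΦ0]; rfl
      rw [multDensity_eq_quadratic]
      simp only [hG0, hpd, mul_zero, add_zero, zero_pow two_ne_zero]
    -- (V) the energy at time `τ`: collar, shell, tail
    have hcEτ := continuous_uncurry_of_param
      (g := fun t r θ ↦ multDensity M M f h w (Kerr.starPull M Φ) (boxPoint φ₀ t r θ)) (cE3 φ₀) τ
    have hV1 : (∫ θ in (0 : ℝ)..π, ∫ r in M..A,
        multDensity M M f h w (Kerr.starPull M Φ) (boxPoint φ₀ τ r θ)) ≤
        -(M ^ 3 / 16) * (∫ θ in (0 : ℝ)..π, ∫ r in M..A, P₁ τ r θ φ₀) +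
          70 * M * (∫ θ in (0 : ℝ)..π, ∫ r in M..A, Z₁ τ r θ φ₀) := by
      have hcP : Continuous (Function.uncurry fun r θ ↦ P₁ τ r θ φ₀) := by
        have hc1 : Continuous fun x : ℝ × ℝ ↦ ((τ, x.1, x.2, φ₀) : ℝ × ℝ × ℝ × ℝ) := by fun_prop
        have hc2 := cP₁.comp hc1; rw [Function.comp_def] at hc2; exact hc2
      have hcZ : Continuous (Function.uncurry fun r θ ↦ Z₁ τ r θ φ₀) := by
        have hc1 : Continuous fun x : ℝ × ℝ ↦ ((τ, x.1, x.2, φ₀) : ℝ × ℝ × ℝ × ℝ) := by fun_prop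
        have hc2 := cZ₁.comp hc1; rw [Function.comp_def] at hc2; exact hc2
      have hcP' : Continuous (Function.uncurry fun r θ ↦ -(M ^ 3 / 16) * P₁ τ r θ φ₀) :=
        continuous_const.mul hcP
      have hcZ' : Continuous (Function.uncurry fun r θ ↦ 70 * M * Z₁ τ r θ φ₀) :=
        continuous_const.mul hcZ
      have hcomb : Continuous (Function.uncurry fun r θ ↦
          -(M ^ 3 / 16) * P₁ τ r θ φ₀ + 70 * M * Z₁ τ r θ φ₀) := hcP'.add hcZ'
      have hle := boxIntegral_mono_on hMA' hcEτ hcomb fun r hr θ hθ ↦ by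
        have hq := nEnergy_collar_ge hM (Kerr.starPull M Φ) (q := boxPoint φ₀ τ r θ)
          (by rw [boxPoint_apply_one]; exact hr.1) (by rw [boxPoint_apply_one]; exact hr.2.trans hA23)
          (by rw [boxPoint_apply_two]; exact hθ)
        rw [multDensity_congr (f₂ := nProfileR M) (h₂ := nProfileT M) (w₂ := nProfileW)
          (by rw [boxPoint_apply_one]; exact (hfN r hr.2).eq_of_nhds)
          (by rw [boxPoint_apply_one]; exact (hhN r hr.2).eq_of_nhds)
          (by rw [boxPoint_apply_one]; exact (hwN r hr.2).eq_of_nhds)]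
        rw [hP₁, hZ₁]
        simp only [boxPoint_apply_two] at hq
        linarith
      rw [boxIntegral_add hcP' hcZ', boxIntegral_const_mul, boxIntegral_const_mul] at hle
      exact hle
    have hV2 : (∫ θ in (0 : ℝ)..π, ∫ r in A..B,
        multDensity M M f h w (Kerr.starPull M Φ) (boxPoint φ₀ τ r θ)) ≤
        Ke * ∫ θ in (0 : ℝ)..π, ∫ r in A..B, J τ r θ φ₀ := by
      have hcJ : Continuous (Function.uncurry fun r θ ↦ Ke * J τ r θ φ₀) := by
        have hc1 : Continuous fun x : ℝ × ℝ ↦ ((τ, x.1, x.2, φ₀) : ℝ × ℝ × ℝ × ℝ) := by fun_prop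
        have hc2 := cJ4.comp hc1
        rw [Function.comp_def] at hc2
        exact continuous_const.mul hc2
      rw [← boxIntegral_const_mul]
      refine boxIntegral_mono_on hAB.le hcEτ hcJ fun r hr θ hθ ↦ (le_abs_self _).trans ?_
      have hb := hKe (Kerr.starPull M Φ) (boxPoint φ₀ τ r θ) (by rw [boxPoint_apply_one]; exact hr)
        (by rw [boxPoint_apply_two]; exact hθ)
      rw [hJ]; simpa only [boxPoint_apply_two] using hb
    have hV3 : (∫ θ in (0 : ℝ)..π, ∫ r in B..r₂,
        multDensity M M f h w (Kerr.starPull M Φ) (boxPoint φ₀ τ r θ)) ≤ 0 := by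
      refine boxIntegral_nonpos hBr₂ hcEτ fun r hr θ hθ ↦ ?_
      rw [multDensity_congr (f₂ := fun _ ↦ 0) (h₂ := fun _ ↦ 1) (w₂ := fun _ ↦ 0)
        (by rw [boxPoint_apply_one]; exact (hfT r hr.1).eq_of_nhds)
        (by rw [boxPoint_apply_one]; exact (hhT r hr.1).eq_of_nhds)
        (by rw [boxPoint_apply_one]; exact (hwT r hr.1).eq_of_nhds), multDensity_T]
      have h0 := tEnergy_extremal_nonneg hM.le (Kerr.starPull M Φ) (q := boxPoint φ₀ τ r θ)
        (by rw [boxPoint_apply_one]; linarith [hr.1]) (by rw [boxPoint_apply_two]; exact hθ)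
      linarith
    have hV : (∫ θ in (0 : ℝ)..π, ∫ r in M..r₂,
        multDensity M M f h w (Kerr.starPull M Φ) (boxPoint φ₀ τ r θ)) ≤
        -(M ^ 3 / 16) * (∫ θ in (0 : ℝ)..π, ∫ r in M..A, P₁ τ r θ φ₀) +
          70 * M * (∫ θ in (0 : ℝ)..π, ∫ r in M..A, Z₁ τ r θ φ₀) +
          Ke * ∫ θ in (0 : ℝ)..π, ∫ r in A..B, J τ r θ φ₀ := by
      rw [boxIntegral_split (b := A) hcEτ, boxIntegral_split (a := A) (b := B) (c := r₂) hcEτ]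
      linarith
    -- (VI) combine
    rw [hI0] at hid
    linarith
  /- ## integrate over `φ₀ ∈ [0, 2π]` -/
  have h2π : (0 : ℝ) ≤ 2 * π := by positivity
  -- continuity in `φ₀` of the five terms
  have cPφ : Continuous fun φ₀ ↦ ∫ θ in (0 : ℝ)..π, ∫ r in M..A, P₁ τ r θ φ₀ := by
    have hc := continuous_boxIntegral_param₂ (J := P₁) cP₁ M A
    have hc2 : Continuous fun φ₀ : ℝ ↦ ((τ, φ₀) : ℝ × ℝ) := by fun_prop
    have hc3 := hc.comp hc2; rw [Function.comp_def] at hc3; exact hc3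
  have cZφ : Continuous fun φ₀ ↦ ∫ θ in (0 : ℝ)..π, ∫ r in M..A, Z₁ τ r θ φ₀ := by
    have hc := continuous_boxIntegral_param₂ (J := Z₁) cZ₁ M A
    have hc2 : Continuous fun φ₀ : ℝ ↦ ((τ, φ₀) : ℝ × ℝ) := by fun_prop
    have hc3 := hc.comp hc2; rw [Function.comp_def] at hc3; exact hc3
  have cJ2 : Continuous fun p : ℝ × ℝ ↦ ∫ θ in (0 : ℝ)..π, ∫ r in A..B, J p.1 r θ p.2 :=
    continuous_boxIntegral_param₂ (J := J) cJ4 A B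
  have cJφ : Continuous fun φ₀ ↦ ∫ θ in (0 : ℝ)..π, ∫ r in A..B, J τ r θ φ₀ := by
    have hc2 : Continuous fun φ₀ : ℝ ↦ ((τ, φ₀) : ℝ × ℝ) := by fun_prop
    have hc3 := cJ2.comp hc2; rw [Function.comp_def] at hc3; exact hc3
  have cJswap : Continuous (Function.uncurry fun φ₀ t ↦ ∫ θ in (0 : ℝ)..π, ∫ r in A..B, J t r θ φ₀) := by
    have hc := cJ2.comp continuous_swap; rw [Function.comp_def] at hc; exact hc
  have cJtφ : Continuous fun φ₀ ↦ ∫ t in (0 : ℝ)..τ, ∫ θ in (0 : ℝ)..π, ∫ r in A..B, J t r θ φ₀ :=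
    intervalIntegral.continuous_parametric_intervalIntegral_of_continuous' cJswap 0 τ
  -- integrate the per-`φ₀` estimate
  have c1 : Continuous fun φ₀ ↦ -Einit φ₀ := cEinit.neg
  have cX : Continuous fun φ₀ ↦ Kb * ∫ t in (0 : ℝ)..τ, ∫ θ in (0 : ℝ)..π, ∫ r in A..B, J t r θ φ₀ :=
    continuous_const.mul cJtφ
  have c3 : Continuous fun φ₀ ↦ 70 * M * ∫ θ in (0 : ℝ)..π, ∫ r in M..A, Z₁ τ r θ φ₀ :=
    continuous_const.mul cZφ
  have c4 : Continuous fun φ₀ ↦ Ke * ∫ θ in (0 : ℝ)..π, ∫ r in A..B, J τ r θ φ₀ :=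
    continuous_const.mul cJφ
  have c12 : Continuous fun φ₀ ↦ -Einit φ₀ +
      Kb * ∫ t in (0 : ℝ)..τ, ∫ θ in (0 : ℝ)..π, ∫ r in A..B, J t r θ φ₀ := c1.add cX
  have c123 : Continuous fun φ₀ ↦ -Einit φ₀ +
      Kb * (∫ t in (0 : ℝ)..τ, ∫ θ in (0 : ℝ)..π, ∫ r in A..B, J t r θ φ₀) +
      70 * M * ∫ θ in (0 : ℝ)..π, ∫ r in M..A, Z₁ τ r θ φ₀ := c12.add c3
  have c1234 : Continuous fun φ₀ ↦ -Einit φ₀ +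
      Kb * (∫ t in (0 : ℝ)..τ, ∫ θ in (0 : ℝ)..π, ∫ r in A..B, J t r θ φ₀) +
      70 * M * (∫ θ in (0 : ℝ)..π, ∫ r in M..A, Z₁ τ r θ φ₀) +
      Ke * ∫ θ in (0 : ℝ)..π, ∫ r in A..B, J τ r θ φ₀ := c123.add c4
  have cL : Continuous fun φ₀ ↦ M ^ 3 / 16 * ∫ θ in (0 : ℝ)..π, ∫ r in M..A, P₁ τ r θ φ₀ :=
    continuous_const.mul cPφ
  have hint := intervalIntegral.integral_mono_on (μ := volume) h2π (cL.intervalIntegrable _ _)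
    (c1234.intervalIntegrable _ _) fun φ₀ _ ↦ key φ₀
  rw [intervalIntegral.integral_const_mul,
    intervalIntegral.integral_add (c123.intervalIntegrable _ _) (c4.intervalIntegrable _ _),
    intervalIntegral.integral_add (c12.intervalIntegrable _ _) (c3.intervalIntegrable _ _),
    intervalIntegral.integral_add (c1.intervalIntegrable _ _) (cX.intervalIntegrable _ _),
    intervalIntegral.integral_neg, intervalIntegral.integral_const_mul,
    intervalIntegral.integral_const_mul, intervalIntegral.integral_const_mul, ← hCinit] at hint
  -- Fubini for the time integral and the hypothesis
  have hswap : (∫ φ₀ in (0 : ℝ)..2 * π, ∫ t in (0 : ℝ)..τ, ∫ θ in (0 : ℝ)..π, ∫ r in A..B, J t r θ φ₀) =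
      ∫ t in (0 : ℝ)..τ, shellIntegral A B (fun r θ φ ↦ J t r θ φ) := by
    rw [intervalIntegral_swap_of_continuous cJswap h2π hτ]
    rfl
  have hJΦ : (fun t ↦ shellIntegral A B (fun r θ φ ↦ J t r θ φ)) = fun t ↦
      shellIntegral A B (fun r θ φ ↦ sin θ *
        (Φ (shellPoint M t r θ φ) ^ 2 +
          (fderiv ℝ Φ (shellPoint M t r θ φ) (E4.basisVector 0)) ^ 2 +
          (fderiv ℝ Φ (shellPoint M t r θ φ) (E4.spaceEmbed (sphRadial θ φ))) ^ 2 +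
          (fderiv ℝ Φ (shellPoint M t r θ φ)
            (E4.spaceEmbed (r • sphPolar θ φ + (M * cos θ) • sphAzimuth φ))) ^ 2)) := by
    funext t
    congr 1
    funext r θ φ
    rw [hJ]
    simp only [dict0, dictT, dictR, dictΘ]
    ring
  have hIτ : (∫ t in (0 : ℝ)..τ, shellIntegral A B (fun r θ φ ↦ J t r θ φ)) ≤ |I| := by
    rw [hJΦ]; exact (hI τ hτ).trans (le_abs_self I)
  -- the zeroth-order term on the collar: Hardy
  have hZ : (∫ φ₀ in (0 : ℝ)..2 * π, ∫ θ in (0 : ℝ)..π, ∫ r in M..A, Z₁ τ r θ φ₀) ≤ 8 * E₀ := by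
    have h8 := shellIntegral_sq_le_initialEnergy hM ⟨hr₀pos, hr₀M⟩ hU₀ hKU hΦ haxi hsol hloc hτ hMA'
    rw [← hE₀] at h8
    have heq : (∫ φ₀ in (0 : ℝ)..2 * π, ∫ θ in (0 : ℝ)..π, ∫ r in M..A, Z₁ τ r θ φ₀) =
        shellIntegral M A (fun r θ φ ↦ sin θ * Φ (shellPoint M τ r θ φ) ^ 2) := by
      rw [hZ₁]; simp only [dict0]; rfl
    rw [heq]; exact h8
  -- the transition shell at time `τ`: degenerate energy and Hardy
  have hJτ : (∫ φ₀ in (0 : ℝ)..2 * π, ∫ θ in (0 : ℝ)..π, ∫ r in A..B, J τ r θ φ₀) ≤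
      2 / m₀ * E₀ + 8 * E₀ := by
    have hΦ1 : ContDiff ℝ 1 Φ := hΦ.of_le (by exact_mod_cast le_top)
    -- pointwise: `J ≤ (2/m₀) e_T + sin θ Φ²`
    have hcJ3 : Continuous fun q : ℝ × ℝ × ℝ ↦ J τ q.1 q.2.1 q.2.2 := by
      have hc1 : Continuous fun x : ℝ × ℝ × ℝ ↦ ((τ, x.1, x.2.1, x.2.2) : ℝ × ℝ × ℝ × ℝ) := by fun_prop
      have hc2 := cJ4.comp hc1; rw [Function.comp_def] at hc2; exact hc2
    have hsq : Continuous fun q : ℝ × ℝ × ℝ ↦ sin q.2.1 * Φ (shellPoint M τ q.1 q.2.1 q.2.2) ^ 2 :=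
      (continuous_sin.comp (continuous_fst.comp continuous_snd)).mul
        ((hΦ.continuous.comp (continuous_shellPoint M τ)).pow 2)
    have hcomb : Continuous fun q : ℝ × ℝ × ℝ ↦ 2 / m₀ * degTEnergyDensity M Φ τ q.1 q.2.1 q.2.2 +
        sin q.2.1 * Φ (shellPoint M τ q.1 q.2.1 q.2.2) ^ 2 :=
      (continuous_const.mul (continuous_degTEnergyDensity₃ hΦ1 M τ)).add hsq
    have hle : shellIntegral A B (fun r θ φ ↦ J τ r θ φ) ≤
        shellIntegral A B (fun r θ φ ↦ 2 / m₀ * degTEnergyDensity M Φ τ r θ φ +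
          sin θ * Φ (shellPoint M τ r θ φ) ^ 2) := by
      refine shellIntegral_mono_on hAB.le hcJ3 hcomb fun r hr θ hθ φ _ ↦ ?_
      have hq := sin_mul_sq_le_tEnergy hM hMA (Kerr.starPull M Φ) (q := boxPoint φ τ r θ)
        (by rw [boxPoint_apply_one]; exact hr.1) (by rw [boxPoint_apply_two]; exact hθ)
      rw [← hm₀, boxPoint_apply_two, tEnergy_starPull_boxPoint (hdiff _)] at hq
      have hdiv : sin θ * (pd 0 (Kerr.starPull M Φ) (boxPoint φ τ r θ) ^ 2 +
          pd 1 (Kerr.starPull M Φ) (boxPoint φ τ r θ) ^ 2 + pd 2 (Kerr.starPull M Φ) (boxPoint φ τ r θ) ^ 2) ≤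
          2 / m₀ * degTEnergyDensity M Φ τ r θ φ := by
        rw [div_mul_eq_mul_div, le_div_iff₀ hm₀pos]; linarith
      rw [hJ]
      simp only [dict0]
      linarith
    rw [shellIntegral_add (continuous_const.mul (continuous_degTEnergyDensity₃ hΦ1 M τ)) hsq,
      shellIntegral_const_mul] at hle
    have h1 : shellIntegral A B (fun r θ φ ↦ degTEnergyDensity M Φ τ r θ φ) ≤ E₀ := by
      have hmono := shellIntegral_mono_interval (g := fun r θ φ ↦ degTEnergyDensity M Φ τ r θ φ)
        hMA' hAB.le le_rfl (continuous_degTEnergyDensity₃ hΦ1 M τ)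
        fun r hr θ hθ φ _ ↦ degTEnergyDensity_nonneg hM.le Φ τ (hM.le.trans hr.1) hθ φ
      have hb := degTEnergyShell_le_initial hM ⟨hr₀pos, hr₀M⟩ hU₀ hKU hΦ haxi hsol hloc hτ hMB
      rw [← hE₀] at hb
      exact hmono.trans hb
    have h2 : shellIntegral A B (fun r θ φ ↦ sin θ * Φ (shellPoint M τ r θ φ) ^ 2) ≤ 8 * E₀ := by
      have hmono := shellIntegral_mono_interval (g := fun r θ φ ↦ sin θ * Φ (shellPoint M τ r θ φ) ^ 2)
        hMA' hAB.le le_rfl hsq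
        fun r _ θ hθ φ _ ↦ mul_nonneg (sin_nonneg_of_nonneg_of_le_pi hθ.1 hθ.2) (sq_nonneg _)
      have hb := shellIntegral_sq_le_initialEnergy hM ⟨hr₀pos, hr₀M⟩ hU₀ hKU hΦ haxi hsol hloc hτ hMB
      rw [← hE₀] at hb
      exact hmono.trans hb
    have heq : (∫ φ₀ in (0 : ℝ)..2 * π, ∫ θ in (0 : ℝ)..π, ∫ r in A..B, J τ r θ φ₀) =
        shellIntegral A B (fun r θ φ ↦ J τ r θ φ) := rfl
    rw [heq]
    have hm2 : 0 ≤ 2 / m₀ := by positivity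
    nlinarith [mul_le_mul_of_nonneg_left h1 hm2]
  -- the left-hand side is the collar integral
  have hlhs : (∫ φ₀ in (0 : ℝ)..2 * π, ∫ θ in (0 : ℝ)..π, ∫ r in M..A, P₁ τ r θ φ₀) =
      shellIntegral M A (fun r θ φ ↦ sin θ *
        (fderiv ℝ Φ (shellPoint M τ r θ φ) (E4.spaceEmbed (sphRadial θ φ))) ^ 2) := by
    rw [hP₁]; simp only [dictR]; rfl
  rw [hlhs, hswap] at hint
  -- assemble
  have hM3 : 0 < M ^ 3 := pow_pos hM 3
  have hKbI : Kb * (∫ t in (0 : ℝ)..τ, shellIntegral A B (fun r θ φ ↦ J t r θ φ)) ≤ Kb * |I| :=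
    mul_le_mul_of_nonneg_left hIτ hKb0
  have hKeJ := mul_le_mul_of_nonneg_left hJτ hKe0
  have h70 : 70 * M * (∫ φ₀ in (0 : ℝ)..2 * π, ∫ θ in (0 : ℝ)..π, ∫ r in M..A, Z₁ τ r θ φ₀) ≤
      70 * M * (8 * E₀) := mul_le_mul_of_nonneg_left hZ (by positivity)
  rw [div_mul_eq_mul_div, le_div_iff₀ hM3]
  have hC := neg_le_abs Cinit
  nlinarith

end Collar

end Literature.Barriers.FinalStateConjecture.Kerr

namespace Literature.Barriers.FinalStateConjecture

open Literature.Geometry.Lorentzian Kerr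

/-- **`Aretakis2012_uniformBoundedness` from integrated local energy decay in a transition shell
(Aretakis 2012: Thm. 2 from Prop. 12.5.1, §13.1).** The named fact (Thm. 2 with Thm. 4 in shell
form, every radius) follows as soon as every globally smooth, everywhere axisymmetric member `Φ`
of Aretakis's class admits radii `M < A < B`, `A ≤ 23M/21`, and a bound `I` with
`∫₀^τ ∫₀^{2π}∫₀^π∫_A^B sin θ (Φ² + (TΦ)² + (∂_ρΦ)² + (∂_ΘΦ)²)(p(t, r, θ, φ)) dr dθ dφ dt ≤ I` for all
`τ ≥ 0` — the integrated local energy decay statement of Prop. 12.5.1 ("Main Estimate II":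
`∫_{{r_e ≤ r ≤ R_e}} [(∂_{r*}ψ)² + ψ² + (r − (1+√2)M)²(|∇̸ψ|² + (Tψ)²)] ≤ C ∫_{Σ₀} J^T_μ[ψ]n^μ`) on a
thin shell away from `𝓗⁺` and from the effective photon sphere (`B < (1 + √2)M` is allowed), for
the members of the class. Proof: `Kerr.collar_rhoDeriv_sq_le_of_transitionILED` (§13.1) and
`Aretakis2012_uniformBoundedness_of_nearHorizonBound` with `δ = A − M`. No named facts are
introduced (D-0026); the displayed hypothesis is what remains of §§9–12 of the source.
[cite: Aretakis2012, §13.1, §12.5 (Prop. 12.5.1), §3 (Thm. 2)] -/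
theorem Aretakis2012_uniformBoundedness_of_transitionILED
    (Hiled : ∀ [Kerr.Facts] [Kerr.SliceFacts] (M : ℝ), 0 < M → ∀ r₀ ∈ Set.Ioo 0 M,
      ∀ (U₀ : Set (Kerr.region M r₀)) (Φ : E4 → ℝ), IsOpen U₀ →
        {x : Kerr.region M r₀ | Kerr.rPlus M M ≤ Kerr.radius M (x : E4) ∧ 0 ≤ (x : E4) 0} ⊆ U₀ →
        ContDiff ℝ ∞ Φ →
        (∀ x ∈ U₀, (Kerr.smoothMetric M M r₀).toPseudoRiemannianMetric.dalembertian
          (fun y : Kerr.region M r₀ ↦ Φ y) x = 0) →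
        (∃ ρ : ℝ, ∀ x ∈ U₀, (x : E4) 0 = 0 → ρ < E4.spatialNorm (x : E4) →
          Φ x = 0 ∧ fderiv ℝ Φ x = 0) →
        (∀ (β : ℝ) (z : E4), Φ (E4.axialRotation β z) = Φ z) →
        ∃ A B I : ℝ, M < A ∧ A < B ∧ A ≤ 23 / 21 * M ∧ ∀ τ : ℝ, 0 ≤ τ →
          (∫ t in (0 : ℝ)..τ, Kerr.shellIntegral A B (fun r θ φ ↦ Real.sin θ *
            (Φ (Kerr.shellPoint M t r θ φ) ^ 2 +
              (fderiv ℝ Φ (Kerr.shellPoint M t r θ φ) (E4.basisVector 0)) ^ 2 +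
              (fderiv ℝ Φ (Kerr.shellPoint M t r θ φ) (E4.spaceEmbed (sphRadial θ φ))) ^ 2 +
              (fderiv ℝ Φ (Kerr.shellPoint M t r θ φ)
                (E4.spaceEmbed (r • sphPolar θ φ + (M * Real.cos θ) • sphAzimuth φ))) ^ 2))) ≤ I) :
    Aretakis2012_uniformBoundedness := by
  refine Aretakis2012_uniformBoundedness_of_nearHorizonBound ?_
  intro _ _ M hM r₀ hr₀ U₀ Φ hU₀ hKU hΦ hsol hloc haxi
  obtain ⟨A, B, I, hMA, hAB, hA23, hI⟩ := Hiled M hM r₀ hr₀ U₀ Φ hU₀ hKU hΦ hsol hloc haxi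
  obtain ⟨ρ, hρ⟩ := hloc
  obtain ⟨C, hC⟩ := collar_rhoDeriv_sq_le_of_transitionILED hM hr₀ hU₀ hKU hΦ haxi hsol hρ hMA
    hAB hA23 hI
  refine ⟨A - M, 0, C, by linarith, fun τ hτ ↦ ?_⟩
  rw [show M + (A - M) = A by ring]
  exact hC τ hτ

end Literature.Barriers.FinalStateConjecture

end
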